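import Summits.ValiantsHypothesis.ValiantsHypothesis.Theorems.FreeSubtorusOrbitDimensionBoundStubStableReductionLattice
import Summits.ValiantsHypothesis.ValiantsHypothesis.Theorems.FreeSubtorusOrbitDimensionBoundStubStableReductionBlocks
import Summits.ValiantsHypothesis.ValiantsHypothesis.Theorems.FreeSubtorusOrbitDimensionBoundStubStableReductionTypes
import Summits.ValiantsHypothesis.ValiantsHypothesis.Theorems.FreeSubtorusOrbitDimensionBoundStubDiagonalLifts

/-!
# `OrbitDimensionBound` (stmt-ValiantsHypothesis-16133), rung line `square_covering` — stub `stub_stableReduction`,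
# part D: the recursion and the registered stub

Last file (part D) for stub 1 `stub_stableReduction` of `Cruxes/OrbitDimensionBound/Lines/square_covering.lean`
(route `FreeSubtorus`, rung `Power.SquareShadow`).  It assembles parts A (`…Lattice`: socle dichotomy), B (`…Split`:
two-block split along an invariant balanced sub-pencil), C (`…AtomBlock`, `…Blocks`, `…Types`: block-diagonal form of a
semisimple pencil, twisted Schur, permutation of block types) and val-lit-p4's saturation lemma
(`…StubDiagonalLifts.exists_admissible_saturation`):

* `exists_stable_piece` — THE RECURSION.  For a subgroup `D` of diagonal substitutions in which every element is an
  `N`-th power (`m! ∣ N`) and a `D`-equivariant affine `m × m` matrix `B` with `det B = c · f^k` (`f` prime, `c ≠ 0`,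
  `k ≥ 1`), there is a `D`-equivariant affine BLOCK-INDECOMPOSABLE matrix `B'` of size `m' ≤ m` with
  `det B' = c' · f^j`, `1 ≤ j ≤ k` (strong induction on `m`: a block-indecomposable `B` is its own answer; otherwise the
  socle dichotomy gives either an invariant proper balanced sub-pencil — split, distribute `f^k` over the two diagonal
  blocks by unique factorisation, recurse on a block carrying a positive power of `f` — or a semisimple
  decomposition — every stable block is `D`-equivariant and one of them carries a positive power of `f`);
* **`stub_stableReduction`** — the registered stub `Stmt.stub_stableReduction` with `torusGen` / `Admissible`
  UNFOLDED: pass from `Λ` to the admissible `Λ'` spanning the saturation (`T_{Λ'} ≤ T_Λ`, every element of `T_{Λ'}` an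
  `m!`-th power), run the recursion with `f = per_n`, and rescale to `det = per_n ^ j` exactly.

Helper mode (`--supports stmt-ValiantsHypothesis-16133 --as helper`).  Honest framing: [folklore] linear algebra closing
ONE registered stub (`stub_stableReduction`, M) of a dormant rung line whose load-bearing stub `stub_gradedPowerCount`
remains OPEN; the rung `SquareShadow`, the crux `OrbitDimensionBound`, the route `FreeSubtorus` and VP ≠ VNP are OPEN and
are not moved by this file.

## References (orientation only)
* A. D. King, Quart. J. Math. 45 (1994), §3–4.
* [LandsbergRessayre2017] J. M. Landsberg, N. Ressayre, Differential Geom. Appl. 55 (2017), §3, §6.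
-/

set_option linter.dupNamespace false

namespace Summit.ValiantsHypothesis.ValiantsHypothesis.Theorems.FreeSubtorusOrbitDimensionBound.SquareCovering.StableReduction

open Matrix MvPolynomial Module
open Literature.Computability.AlgebraicComplexity
open Summit.ValiantsHypothesis.ValiantsHypothesis.Theorems.FreeSubtorusOrbitDimensionBound.SignCovering.PerSummand

/-! ### §1 The recursion -/

section Recursion

variable {σ : Type*} [Fintype σ] [DecidableEq σ]

omit [Fintype σ] [DecidableEq σ] in
/-- Units of `ℂ[x]` are the non-zero constants. [folklore] -/
theorem exists_eq_C_of_isUnit {u : MvPolynomial σ ℂ} (hu : IsUnit u) : ∃ c : ℂ, c ≠ 0 ∧ u = C c := by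
  obtain ⟨c, hc, rfl⟩ := MvPolynomial.isUnit_iff_eq_C_of_isReduced.1 hu
  exact ⟨c, hc.ne_zero, rfl⟩

omit [Fintype σ] [DecidableEq σ] in
/-- Distributing a prime power over a product of two: if `x · y = C c · f^k` (`c ≠ 0`, `f` prime) then
`x = C c₁ · f^{j₁}`, `y = C c₂ · f^{j₂}` with `j₁ + j₂ = k`, `c₁, c₂ ≠ 0`. [folklore] -/
theorem exists_eq_C_mul_pow_of_mul_eq {f x y : MvPolynomial σ ℂ} (hf : Prime f) {c : ℂ} (hc : c ≠ 0) {k : ℕ}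
    (h : x * y = C c * f ^ k) :
    ∃ (j₁ j₂ : ℕ) (c₁ c₂ : ℂ), j₁ + j₂ = k ∧ c₁ ≠ 0 ∧ c₂ ≠ 0 ∧ x = C c₁ * f ^ j₁ ∧ y = C c₂ * f ^ j₂ := by
  obtain ⟨j₁, j₂, b₁, b₂, hj, hb, rfl, rfl⟩ := mul_eq_mul_prime_pow hf h
  have hbu : IsUnit (b₁ * b₂) := by rw [← hb]; exact (IsUnit.mk0 c hc).map C
  obtain ⟨c₁, hc₁, rfl⟩ := exists_eq_C_of_isUnit (isUnit_of_mul_isUnit_left hbu)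
  obtain ⟨c₂, hc₂, rfl⟩ := exists_eq_C_of_isUnit (isUnit_of_mul_isUnit_right hbu)
  exact ⟨j₁, j₂, c₁, c₂, hj, hc₁, hc₂, rfl, rfl⟩

/-- **The recursion** (see the module docstring). [folklore] -/
theorem exists_stable_piece (D : Subgroup (GL σ ℂ)) (hD : ∀ γ ∈ D, ∃ t : σ → ℂ, (γ : Matrix σ σ ℂ) = Matrix.diagonal t)
    (N : ℕ) (hdiv : ∀ γ ∈ D, ∃ δ ∈ D, δ ^ N = γ) (f : MvPolynomial σ ℂ) (hf : Prime f) (m : ℕ) :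
    m.factorial ∣ N →
    ∀ (B : Matrix (Fin m) (Fin m) (MvPolynomial σ ℂ)) (c : ℂ) (k : ℕ), c ≠ 0 → 1 ≤ k →
      (∀ i j, (B i j).totalDegree ≤ 1) → B.det = C c * f ^ k →
      (∀ γ ∈ D, ∃ g h : GL (Fin m) ℂ, Matrix.linSubstEntries γ B =
        (g : Matrix (Fin m) (Fin m) ℂ).map C * B * ((h⁻¹ : GL (Fin m) ℂ) : Matrix (Fin m) (Fin m) ℂ).map C) →
      ∃ (m' j : ℕ) (c' : ℂ) (B' : Matrix (Fin m') (Fin m') (MvPolynomial σ ℂ)),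
        m' ≤ m ∧ 1 ≤ j ∧ j ≤ k ∧ c' ≠ 0 ∧ (∀ i j, (B' i j).totalDegree ≤ 1) ∧ B'.det = C c' * f ^ j ∧
        (∀ γ ∈ D, ∃ g h : GL (Fin m') ℂ, Matrix.linSubstEntries γ B' =
          (g : Matrix (Fin m') (Fin m') ℂ).map C * B' * ((h⁻¹ : GL (Fin m') ℂ) : Matrix (Fin m') (Fin m') ℂ).map C) ∧
        ¬ IsBlockDecomposable B' := by
  classical
  induction m using Nat.strong_induction_on with
  | _ m ih => ?_
  intro hmN B c k hc hk hBaff hBdet hlift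
  by_cases hstab : IsBlockDecomposable B
  swap
  · exact ⟨m, k, c, B, le_rfl, hk, le_rfl, hc, hBaff, hBdet, hlift, hstab⟩
  -- `B` is block-decomposable: run the socle dichotomy
  have hm2 : 2 ≤ m := hstab.two_le
  have hdet : B.det ≠ 0 := by
    rw [hBdet]; exact mul_ne_zero (by rw [Ne, C_eq_zero]; exact hc) (pow_ne_zero _ hf.ne_zero)
  set F : (σ →₀ ℕ) → (Fin m → ℂ) →ₗ[ℂ] (Fin m → ℂ) := fun e => Matrix.toLin' (B.map (coeff e)) with hF
  have hss : ∀ V : Submodule ℂ (Fin m → ℂ), finrank ℂ V ≤ finrank ℂ ↥(⨆ e, V.map (F e)) := by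
    intro V
    by_contra hlt
    refine hdet (det_eq_zero_of_subpencil B V (⨆ e, V.map (F e)) (fun e x hx => ?_) (not_le.1 hlt))
    exact Submodule.mem_iSup_of_mem e (Submodule.mem_map_of_mem hx)
  -- the compatible automorphism pairs: exact lifts of elements of `D`
  let Φ : Set (((Fin m → ℂ) ≃ₗ[ℂ] (Fin m → ℂ)) × ((Fin m → ℂ) ≃ₗ[ℂ] (Fin m → ℂ))) :=
    {p | ∃ γ ∈ D, ∃ g h : GL (Fin m) ℂ, Matrix.linSubstEntries γ B =
        (g : Matrix (Fin m) (Fin m) ℂ).map C * B * ((h⁻¹ : GL (Fin m) ℂ) : Matrix (Fin m) (Fin m) ℂ).map C ∧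
      p = (Matrix.toLinearEquiv' (h : Matrix (Fin m) (Fin m) ℂ) h.invertible,
        Matrix.toLinearEquiv' (g : Matrix (Fin m) (Fin m) ℂ) g.invertible)}
  have hΦ : ∀ p ∈ Φ, ∀ (e : σ →₀ ℕ) (V : Submodule ℂ (Fin m → ℂ)),
      (V.map (p.1 : (Fin m → ℂ) →ₗ[ℂ] (Fin m → ℂ))).map (F e) =
        (V.map (F e)).map (p.2 : (Fin m → ℂ) →ₗ[ℂ] (Fin m → ℂ)) := by
    rintro p ⟨γ, hγ, g, h, hgh, rfl⟩ e V
    obtain ⟨t, ht⟩ := hD γ hγ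
    exact map_toLin_map_eq_of_lift γ t ht B g h hgh e V
  have hm0 : 0 < finrank ℂ (Fin m → ℂ) := by rw [finrank_fin_fun]; omega
  rcases invariant_or_semisimple F hss rfl hm0 Φ hΦ with ⟨V, hV0, hVtop, hVbal, hVinv⟩ | ⟨T, hT, hVint, hWint⟩
  · -- CASE 1: an invariant proper balanced sub-pencil — split and recurse
    set W : Submodule ℂ (Fin m → ℂ) := ⨆ e, V.map (F e) with hW
    have hd : finrank ℂ W = finrank ℂ V := le_antisymm hVbal (hss V)
    have hdpos : 0 < finrank ℂ V := by
      rw [pos_iff_ne_zero, Ne, Submodule.finrank_eq_zero]; exact hV0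
    have hdlt : finrank ℂ V < m := by
      have := Submodule.finrank_lt hVtop; rwa [finrank_fin_fun] at this
    have hlift' : ∀ γ ∈ (D : Set (GL σ ℂ)), ∃ g h : GL (Fin m) ℂ,
        Matrix.linSubstEntries γ B =
            (g : Matrix (Fin m) (Fin m) ℂ).map C * B * ((h⁻¹ : GL (Fin m) ℂ) : Matrix (Fin m) (Fin m) ℂ).map C ∧
          V.map (Matrix.toLin' (h : Matrix (Fin m) (Fin m) ℂ)) = V ∧
          W.map (Matrix.toLin' (g : Matrix (Fin m) (Fin m) ℂ)) = W := by
      intro γ hγ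
      obtain ⟨g, h, hgh⟩ := hlift γ hγ
      have hp := hVinv (Matrix.toLinearEquiv' (h : Matrix (Fin m) (Fin m) ℂ) h.invertible,
        Matrix.toLinearEquiv' (g : Matrix (Fin m) (Fin m) ℂ) g.invertible) ⟨γ, hγ, g, h, hgh, rfl⟩
      exact ⟨g, h, hgh, hp.1, hp.2⟩
    obtain ⟨B₁, B₂, hB₁aff, hB₂aff, ⟨c₀, hc₀, hdet12⟩, hlift₁, hlift₂⟩ :=
      exists_twoBlock_split B hBaff V W (fun e x hx => Submodule.mem_iSup_of_mem e (Submodule.mem_map_of_mem hx))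
        hd hdlt.le (D : Set (GL σ ℂ)) hlift'
    rw [hBdet, ← mul_assoc, ← map_mul] at hdet12
    obtain ⟨j₁, j₂, c₁, c₂, hj, hc₁, hc₂, hB₁det, hB₂det⟩ := exists_eq_C_mul_pow_of_mul_eq hf (mul_ne_zero hc₀ hc) hdet12
    by_cases hj₁ : 1 ≤ j₁
    · obtain ⟨m', j, c', B', hm', hj1, hjk, hc', hB'aff, hB'det, hB'lift, hB'stab⟩ :=
        ih (finrank ℂ V) hdlt ((Nat.factorial_dvd_factorial hdlt.le).trans hmN) B₁ c₁ j₁ hc₁ hj₁ hB₁aff hB₁det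
          hlift₁
      exact ⟨m', j, c', B', hm'.trans hdlt.le, hj1, by omega, hc', hB'aff, hB'det, hB'lift, hB'stab⟩
    · have hj₂ : 1 ≤ j₂ := by omega
      have hlt₂ : m - finrank ℂ V < m := by omega
      obtain ⟨m', j, c', B', hm', hj1, hjk, hc', hB'aff, hB'det, hB'lift, hB'stab⟩ :=
        ih (m - finrank ℂ V) hlt₂ ((Nat.factorial_dvd_factorial hlt₂.le).trans hmN) B₂ c₂ j₂ hc₂ hj₂ hB₂aff hB₂det
          hlift₂
      exact ⟨m', j, c', B', hm'.trans hlt₂.le, hj1, by omega, hc', hB'aff, hB'det, hB'lift, hB'stab⟩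
  · -- CASE 2: semisimple — block-diagonal form, every stable block is equivariant
    obtain ⟨blk, hblkaff, ⟨c₀, hc₀, hprod⟩, hblkdet, hblkstab, hrel⟩ :=
      exists_blockDiagonal_form B hBaff hdet T hT hVint hWint (D : Set (GL σ ℂ)) hD hlift
    -- every block is equivariant
    have hcardT : (Fintype.card T).factorial ∣ N := by
      refine (Nat.factorial_dvd_factorial ?_).trans hmN
      -- `#T ≤ m`: the atoms are non-zero and their dimensions add up to `m`
      have h1 := finrank_eq_card_basis (hVint.collectedBasis fun A : T => Module.finBasis ℂ (A : Submodule ℂ (Fin m → ℂ)))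
      rw [finrank_fin_fun, Fintype.card_sigma] at h1
      calc Fintype.card T = ∑ A : T, 1 := by simp
        _ ≤ ∑ A : T, Fintype.card (Fin (finrank ℂ (A : Submodule ℂ (Fin m → ℂ)))) :=
          Finset.sum_le_sum fun A _ => by
            rw [Fintype.card_fin, Nat.one_le_iff_ne_zero, Ne, Submodule.finrank_eq_zero]; exact (hT A A.2).1
        _ = m := h1.symm
    have hequiv := blocks_equivariant (fun A : T => finrank ℂ (A : Submodule ℂ (Fin m → ℂ))) blk hblkdet hblkstab D hD
      N hcardT hdiv hrel
    -- one block carries a positive power of `f`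
    rw [hBdet, ← mul_assoc, ← map_mul] at hprod
    have hdvd : f ∣ ∏ A : T, (blk A).det := by
      rw [hprod]; exact Dvd.dvd.mul_left (dvd_pow_self f (by omega)) _
    obtain ⟨A₀, -, hA₀⟩ := hf.exists_mem_finset_dvd hdvd
    rw [← Finset.mul_prod_erase Finset.univ (fun A : T => (blk A).det) (Finset.mem_univ A₀)] at hprod
    obtain ⟨j₁, j₂, c₁, c₂, hj, hc₁, hc₂, hA₀det, -⟩ := exists_eq_C_mul_pow_of_mul_eq hf (mul_ne_zero hc₀ hc) hprod
    have hj₁ : 1 ≤ j₁ := by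
      by_contra h0
      have h00 : j₁ = 0 := by omega
      rw [hA₀det, h00, pow_zero, mul_one] at hA₀
      exact hf.not_unit (isUnit_of_dvd_unit hA₀ ((IsUnit.mk0 c₁ hc₁).map C))
    refine ⟨finrank ℂ (A₀ : Submodule ℂ (Fin m → ℂ)), j₁, c₁, blk A₀, ?_, hj₁, by omega, hc₁, hblkaff A₀, hA₀det,
      fun γ hγ => hequiv γ hγ A₀, hblkstab A₀⟩
    have := Submodule.finrank_le (A₀ : Submodule ℂ (Fin m → ℂ))
    rwa [finrank_fin_fun] at this

end Recursion

/-! ### §2 The registered stub -/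

section Stub

/-- **Stub 1 `stub_stableReduction` of the line `square_covering`** (`Stmt.stub_stableReduction` with `torusGen` and
`Admissible` unfolded): a `T_Λ`-equivariant affine determinantal representation of `per_n ^ k` (`n ≥ 3`, `k ≥ 1`,
`Λ` admissible) contains a BLOCK-INDECOMPOSABLE affine determinantal representation of some `per_n ^ j`, `1 ≤ j ≤ k`,
of size `≤ m`, equivariant under the torus `T_{Λ'}` of an admissible `Λ'` of the same number of rows (a basis of the
saturation of the lattice spanned by `Λ`, padded with zero rows).  Proof: saturation (`T_{Λ'} ≤ T_Λ` is divisible),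
the recursion `exists_stable_piece` through King's category of `θ`-semistable pencils, and a scalar rescaling.
[cite: LandsbergRessayre2017, §3, §6] -/
theorem stub_stableReduction :
    ∀ (n k m r : ℕ) (Λ : Fin r → (Fin n ⊕ Fin n) → ℤ) (B : Matrix (Fin m) (Fin m) (MvPolynomial (Fin n × Fin n) ℂ)),
      3 ≤ n → 1 ≤ k → (∀ i, (∑ k, Λ i (Sum.inl k)) = 0 ∧ (∑ l, Λ i (Sum.inr l)) = 0) →
      IsEquivariantDetRepr (Subgroup.closure {γ : Matrix.GeneralLinearGroup (Fin n × Fin n) ℂ |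
          ∃ d e : Fin n → ℂˣ, (∀ i, (∏ k, (d k) ^ (Λ i (Sum.inl k))) * (∏ l, (e l) ^ (Λ i (Sum.inr l))) = 1) ∧
            (γ : Matrix (Fin n × Fin n) (Fin n × Fin n) ℂ) = Matrix.diagonal (fun p => (d p.1 : ℂ) * (e p.2 : ℂ))})
        (perPoly (Fin n) ℂ ^ k) B →
      ∃ (j m' : ℕ) (Λ' : Fin r → (Fin n ⊕ Fin n) → ℤ) (B' : Matrix (Fin m') (Fin m') (MvPolynomial (Fin n × Fin n) ℂ)),
        1 ≤ j ∧ j ≤ k ∧ m' ≤ m ∧ (∀ i, (∑ k, Λ' i (Sum.inl k)) = 0 ∧ (∑ l, Λ' i (Sum.inr l)) = 0) ∧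
        IsEquivariantDetRepr (Subgroup.closure {γ : Matrix.GeneralLinearGroup (Fin n × Fin n) ℂ |
            ∃ d e : Fin n → ℂˣ, (∀ i, (∏ k, (d k) ^ (Λ' i (Sum.inl k))) * (∏ l, (e l) ^ (Λ' i (Sum.inr l))) = 1) ∧
              (γ : Matrix (Fin n × Fin n) (Fin n × Fin n) ℂ) = Matrix.diagonal (fun p => (d p.1 : ℂ) * (e p.2 : ℂ))})
          (perPoly (Fin n) ℂ ^ j) B' ∧
        ¬ IsBlockDecomposable B' := by
  intro n k m r Λ B hn hk hΛ hB
  classical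
  haveI : Nonempty (Fin n) := ⟨⟨0, by omega⟩⟩
  have hirr : Irreducible (perPoly (Fin n) ℂ) := perPoly_irreducible
  have hper : Prime (perPoly (Fin n) ℂ) := UniqueFactorizationMonoid.irreducible_iff_prime.mp hirr
  -- saturation: `Λ'` admissible, `T_{Λ'} ≤ T_Λ`, every element of `T_{Λ'}` an `m!`-th power
  obtain ⟨Λ', hΛ', hsub, hroot⟩ := exists_admissible_saturation Λ hΛ m.factorial (Nat.factorial_pos m)
  set S' : Set (GL (Fin n × Fin n) ℂ) := {γ : Matrix.GeneralLinearGroup (Fin n × Fin n) ℂ |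
      ∃ d e : Fin n → ℂˣ, (∀ i, (∏ k, (d k) ^ (Λ' i (Sum.inl k))) * (∏ l, (e l) ^ (Λ' i (Sum.inr l))) = 1) ∧
        (γ : Matrix (Fin n × Fin n) (Fin n × Fin n) ℂ) = Matrix.diagonal (fun p => (d p.1 : ℂ) * (e p.2 : ℂ))} with hS'
  set D : Subgroup (GL (Fin n × Fin n) ℂ) := Subgroup.closure S' with hDdef
  have hDle : D ≤ Subgroup.closure {γ : Matrix.GeneralLinearGroup (Fin n × Fin n) ℂ |
      ∃ d e : Fin n → ℂˣ, (∀ i, (∏ k, (d k) ^ (Λ i (Sum.inl k))) * (∏ l, (e l) ^ (Λ i (Sum.inr l))) = 1) ∧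
        (γ : Matrix (Fin n × Fin n) (Fin n × Fin n) ℂ) = Matrix.diagonal (fun p => (d p.1 : ℂ) * (e p.2 : ℂ))} :=
    Subgroup.closure_mono fun γ ⟨d, e, hde, hγ⟩ => ⟨d, e, hsub d e hde, hγ⟩
  have hDdiag : ∀ γ ∈ D, ∃ t : Fin n × Fin n → ℂ, (γ : Matrix (Fin n × Fin n) (Fin n × Fin n) ℂ) = Matrix.diagonal t :=
    fun γ hγ => exists_eq_diagonal_of_mem_closure S' (by rintro γ ⟨d, e, -, hγ⟩; exact ⟨_, hγ⟩) γ hγ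
  have hDdiv : ∀ γ ∈ D, ∃ δ ∈ D, δ ^ m.factorial = γ := by
    intro γ hγ
    obtain ⟨d, e, hde, hγ'⟩ := mem_torusGen_of_mem_closure Λ' γ hγ
    obtain ⟨d', e', hde', hd', he'⟩ := hroot d e hde
    refine ⟨Matrix.GeneralLinearGroup.mkOfDetNeZero _ (det_diagonal_units_ne_zero d' e'),
      Subgroup.subset_closure ⟨d', e', hde', Matrix.GeneralLinearGroup.val_mkOfDetNeZero _ _⟩, ?_⟩
    refine Units.ext ?_
    rw [Units.val_pow_eq_pow_val, Matrix.GeneralLinearGroup.val_mkOfDetNeZero, Matrix.diagonal_pow, hγ']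
    refine congrArg Matrix.diagonal (funext fun p => ?_)
    simp only [Pi.pow_apply, mul_pow, ← Units.val_pow_eq_pow_val, hd', he']
  -- the recursion
  have hBD := hB.anti hDle
  obtain ⟨m', j, c', B', hm', hj1, hjk, hc', hB'aff, hB'det, hB'lift, hB'stab⟩ :=
    exists_stable_piece D hDdiag m.factorial hDdiv (perPoly (Fin n) ℂ) hper m dvd_rfl B 1 k one_ne_zero hk hBD.1.1
      (by rw [C_1, one_mul]; exact hBD.1.2) hBD.2
  -- rescale to `det = per_n ^ j`
  have hm'0 : 0 < m' := by
    rcases Nat.eq_zero_or_pos m' with h0 | h0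
    · exfalso
      subst h0
      have h1 : B'.det = 1 := Matrix.det_isEmpty
      rw [h1] at hB'det
      have h2 : IsUnit (perPoly (Fin n) ℂ ^ j) := isUnit_of_mul_isUnit_right (hB'det ▸ isUnit_one)
      exact hirr.not_isUnit ((isUnit_pow_iff (by omega)).1 h2)
    · exact h0
  obtain ⟨ξ, hξ⟩ := IsAlgClosed.exists_pow_nat_eq (c'⁻¹) hm'0
  have hξ0 : ξ ≠ 0 := by
    intro h0
    rw [h0, zero_pow hm'0.ne'] at hξ
    exact inv_ne_zero hc' hξ.symm
  set Z : Matrix (Fin m') (Fin m') ℂ := ξ • (1 : Matrix (Fin m') (Fin m') ℂ) with hZ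
  have hZdet : Z.det ≠ 0 := by
    rw [hZ, Matrix.det_smul, Matrix.det_one, mul_one, Fintype.card_fin]; exact pow_ne_zero _ hξ0
  have hZC : (Z.map C : Matrix (Fin m') (Fin m') (MvPolynomial (Fin n × Fin n) ℂ)) =
      (C ξ : MvPolynomial (Fin n × Fin n) ℂ) • (1 : Matrix (Fin m') (Fin m') (MvPolynomial (Fin n × Fin n) ℂ)) := by
    ext i j
    by_cases hij : i = j
    · subst hij; simp [hZ]
    · simp [hZ, hij]
  refine ⟨j, m', Λ', Z.map C * B', hj1, hjk, hm', hΛ', ⟨⟨fun i j' => ?_, ?_⟩, fun γ hγ => ?_⟩, ?_⟩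
  · rw [hZ, smul_one_map_C_mul_apply]
    exact (totalDegree_mul _ _).trans (by rw [totalDegree_C, zero_add]; exact hB'aff i j')
  · rw [Matrix.det_mul, det_map_C, hZ, Matrix.det_smul, Matrix.det_one, mul_one, Fintype.card_fin, hξ, hB'det,
      ← mul_assoc, ← map_mul, inv_mul_cancel₀ hc', C_1, one_mul]
  · obtain ⟨g, h, hgh⟩ := hB'lift γ hγ
    refine ⟨g, h, ?_⟩
    rw [Matrix.linSubstEntries_mul, Matrix.linSubstEntries_map_C, hgh, hZC]
    simp only [Matrix.smul_mul, Matrix.mul_smul, Matrix.one_mul]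
  · have h1 : (Z.map C * B' : Matrix (Fin m') (Fin m') (MvPolynomial (Fin n × Fin n) ℂ)) =
        ((Matrix.GeneralLinearGroup.mkOfDetNeZero Z hZdet : GL (Fin m') ℂ) : Matrix (Fin m') (Fin m') ℂ).map C * B' *
          (((1 : GL (Fin m') ℂ) : Matrix (Fin m') (Fin m') ℂ)).map C := by
      rw [Matrix.GeneralLinearGroup.val_mkOfDetNeZero, Units.val_one, Matrix.map_one C C_0 C_1, Matrix.mul_one]
    rw [h1, isBlockDecomposable_baseChange_iff]
    exact hB'stab

end Stub

end Summit.ValiantsHypothesis.ValiantsHypothesis.Theorems.FreeSubtorusOrbitDimensionBound.SquareCovering.StableReduction
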